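import Summits.ResolutionOfSingularities.ResolutionOfSingularities.Theorems.RadicialJungCleanModelsSufficeGameCount
import Literature.AlgebraicGeometry.Resolution.AntichainCount

/-!
# Route `RadicialJung`, crux `CleanModelsSuffice`, line `Sketch`: the exceptionalisation game —
# (E) the INTRINSIC COUNT of charged components near a point

Helper for the registered stubs `stub_gameCentre1` / `stub_gameCentre2` of the skeleton of
`Summit.ResolutionOfSingularities.ResolutionOfSingularities.Theses.RadicialJung.CleanModelsSuffice`
(stmt-ResolutionOfSingularities-15883): `GameState.exists_nhds_card_ch_eq` — on a neighbourhood of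
`v`, whenever `w` has at least two charged coordinates, or at least two of the coordinate divisors
`cl(η_i)` (`i` charged at `v`) pass through `w`, the two numbers agree:
`|ch w| = #{i ∈ ch v | η_i ⤳ w}`. Proof: the maximal generisations of `w` inside the
normalisation-singular locus `S₂` are the `η^w_t` (`t` a pair of charged coordinates of `w`, (B) at
`w`, `…GameGerms`) and also the `η_t ⤳ w` (`t` a pair of charged coordinates of `v`, (C),
`…GameCount`); two dominating antichains have the same size
(`card_eq_of_forall_exists_of_antichain`, `AntichainCount.lean`), so `C(|ch w|, 2) = C(c, 2)`, and
`C(·, 2)` is injective.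
-/

noncomputable section

set_option linter.dupNamespace false -- mandated namespace of this single-conjunct summit

open CategoryTheory AlgebraicGeometry TopologicalSpace IsLocalRing
open Literature.AlgebraicGeometry.Resolution Literature.AlgebraicGeometry.Motives
open Summit.ResolutionOfSingularities.ResolutionOfSingularities.Theorems.Picover

namespace Summit.ResolutionOfSingularities.ResolutionOfSingularities.Theorems.RadicialJung.CleanModelsSuffice

attribute [local instance] stalkAlgebra isScalarTower_stalkAlgebra

/-- If `C(m, 2) = C(c, 2)` with `m ≥ 2` then `m = c` (`C(·, 2)` vanishes below `2` and is injective
from `1` on). [folklore] -/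
theorem eq_of_two_le_of_choose_two_eq {m c : ℕ} (hm : 2 ≤ m) (h : m.choose 2 = c.choose 2) : m = c := by
  have hc1 : 1 ≤ c := by
    by_contra hc0
    have : c = 0 := by omega
    rw [this, Nat.choose_zero_succ] at h
    exact absurd h (Nat.choose_pos hm).ne'
  exact Nat.eq_of_choose_two_eq (by omega) hc1 h

namespace GameState

variable {p : ℕ} {V₀ : Scheme.{0}} [IsIntegral V₀] {L : Type} [Field L] [Algebra V₀.functionField L]
  {V : Scheme.{0}} [IsIntegral V] {π : V ⟶ V₀} [IsDominant π]
  (S : GameState p V₀ L V π) [Algebra V.functionField L]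
  (hp : p.Prime) (k : Type) [Field k] [CharP k p] (f : V ⟶ Spec (.of k)) [LocallyOfFiniteType f]
  (hdegV : Module.finrank V.functionField L = p)
  (hrange : Set.range (algebraMap V.functionField L) = Set.range (algebraMap V₀.functionField L))
  (hcompat : ∀ g : V₀.functionField,
    algebraMap V.functionField L (RatFn.functionFieldMap π g) = algebraMap V₀.functionField L g)

/-! ## (E) The intrinsic count of charged components -/

include hp f hdegV hrange hcompat in
open Classical in
/-- **(E) The number of charged components through a point is intrinsic.** There is an open
`U ∋ v` such that for `w ∈ U`, whenever `w` has at least two charged coordinates OR at least two of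
the coordinate divisors `cl(η_i)` (`i` charged at `v`) pass through `w`, the two counts agree:
`|ch w| = #{i ∈ ch v | η_i ⤳ w}`. Proof: in either case `w ∈ S₂`; the maximal generisations of `w`
lying in `S₂` are the `η^w_{t}` (`t` a pair of charged coordinates of `w`, by (B) at `w`) and also
the `η_t ⤳ w` (`t` a pair of charged coordinates of `v`, by (C)); two dominating antichains have
the same size (`card_eq_of_forall_exists_of_antichain`), so `C(|ch w|, 2) = C(c, 2)` with
`c = #{i ∈ ch v | η_i ⤳ w}` (pairs through `w` ↔ both members through `w`,
`exists_nhds_gen_specializes_iff`), and `C(·, 2)` is injective. [folklore] -/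
theorem exists_nhds_card_ch_eq (v : V) :
    ∃ U : V.Opens, v ∈ U ∧ ∀ w ∈ U,
      (2 ≤ (S.ch w).card ∨ 2 ≤ ((S.ch v).filter fun i => S.gen v {i} ⤳ w).card) →
        (S.ch w).card = ((S.ch v).filter fun i => S.gen v {i} ⤳ w).card := by
  classical
  set S₂ : Set V := {w | ¬ IsRegularLocalRing (integralClosure (V.presheaf.stalk w) L)} with hS₂_def
  have hS₂ : IsClosed S₂ := S.isClosed_singTwo hp k f hdegV hrange hcompat
  have hB' : ∀ w, w ∈ S₂ ↔ 2 ≤ (S.ch w).card := fun w =>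
    S.not_isRegularLocalRing_iff_two_le_card_ch hp k f hdegV hrange hcompat w
  have hmemch : ∀ (w : V) (i : Fin (S.d w)), i ∈ S.ch w ↔ S.a w i ≠ 0 := fun w i => by
    simp [GameState.ch]
  by_cases hch : ∃ i, S.a v i ≠ 0
  swap
  · -- no charged coordinate at `v`: take `U = S₂ᶜ`, the hypothesis never holds there
    push Not at hch
    have hchv : S.ch v = ∅ := Finset.filter_eq_empty_iff.mpr fun i _ => by simpa using hch i
    have hv : v ∉ S₂ := fun h => by
      have := (hB' v).mp h
      rw [hchv, Finset.card_empty] at this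
      omega
    refine ⟨⟨S₂ᶜ, hS₂.isOpen_compl⟩, hv, fun w hw h => ?_⟩
    exfalso
    rcases h with h | h
    · exact hw ((hB' w).mpr h)
    · rw [hchv, Finset.filter_empty, Finset.card_empty] at h
      omega
  -- (C) near `v`
  obtain ⟨U₁, hvU₁, hU₁⟩ := S.exists_nhds_not_isRegularLocalRing_iff hp k f hdegV hrange hcompat v hch
  choose Ut hvUt hUt using fun t : Finset (Fin (S.d v)) => S.exists_nhds_gen_specializes_iff k f v t
  let U₂ : V.Opens := ⟨⋂ t ∈ (S.ch v).powersetCard 2, (Ut t : Set V),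
    isOpen_biInter_finset fun t _ => (Ut t).isOpen⟩
  have hvU₂ : v ∈ U₂ := by
    simp only [U₂, Opens.mem_mk, Set.mem_iInter, SetLike.mem_coe]
    exact fun t _ => hvUt t
  refine ⟨U₁ ⊓ U₂, ⟨hvU₁, hvU₂⟩, fun w hw hyp2 => ?_⟩
  have hw₁ : w ∈ U₁ := hw.1
  have hw₂ : ∀ t ∈ (S.ch v).powersetCard 2, w ∈ Ut t := by
    have h := hw.2
    simp only [U₂, Opens.mem_mk, Set.mem_iInter, SetLike.mem_coe] at h
    exact h
  -- pairs through `w` ↔ both members through `w`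
  have hpair : ∀ t ∈ (S.ch v).powersetCard 2, (S.gen v t ⤳ w ↔ ∀ i ∈ t, S.gen v {i} ⤳ w) :=
    fun t ht => hUt t w (hw₂ t ht)
  /- Step A: `w ∈ S₂`, so `w` has two charged coordinates -/
  have hwS₂ : w ∈ S₂ := by
    rcases hyp2 with h | h
    · exact (hB' w).mpr h
    · obtain ⟨i, hi, j, hj, hij⟩ := Finset.one_lt_card.mp h
      rw [Finset.mem_filter] at hi hj
      have ht : ({i, j} : Finset _) ∈ (S.ch v).powersetCard 2 :=
        (S.mem_powersetCard_two_iff _).mpr ⟨i, j, hij, (hmemch v i).mp hi.1, (hmemch v j).mp hj.1, rfl⟩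
      have hgen : S.gen v {i, j} ⤳ w := (hpair _ ht).mpr fun x hx => by
        rcases Finset.mem_insert.mp hx with rfl | hx
        · exact hi.2
        · rw [Finset.mem_singleton.mp hx]; exact hj.2
      exact (hU₁ w hw₁).mpr ⟨{i, j}, ht, hgen⟩
  have hchw2 : 2 ≤ (S.ch w).card := (hB' w).mp hwS₂
  have hchw : ∃ i, S.a w i ≠ 0 := by
    obtain ⟨i, hi, -⟩ := Finset.one_lt_card.mp hchw2
    exact ⟨i, (hmemch w i).mp hi⟩
  /- Step B: the two dominating antichains of `G = {η ⤳ w | η ∈ S₂}` -/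
  let ι := {t // t ∈ (S.ch w).powersetCard 2}
  let ι' := {t // t ∈ ((S.ch v).powersetCard 2).filter fun t => S.gen v t ⤳ w}
  have hcardt : ∀ {u : V} (t : Finset (Fin (S.d u))) (s : Finset (Fin (S.d u))),
      t ∈ s.powersetCard 2 → t.card = 2 := fun t s ht => (Finset.mem_powersetCard.mp ht).2
  have hcount : Fintype.card ι = Fintype.card ι' := by
    refine card_eq_of_forall_exists_of_antichain (fun η η' : V => η ⤳ η')
      (fun a b c hab hbc => hab.trans hbc) (fun a b hab hba => (hab.antisymm hba).eq)
      {η | η ⤳ w ∧ η ∈ S₂} (fun t : ι => S.gen w t.1) (fun t : ι' => S.gen v t.1)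
      (fun t => ⟨S.gen_specializes w t.1, ?_⟩) (fun η hη => ?_) (fun t t' h => ?_)
      (fun t => ⟨(Finset.mem_filter.mp t.2).2, ?_⟩) (fun η hη => ?_) (fun t t' h => ?_)
      (fun _ => specializes_rfl) (fun _ => specializes_rfl)
    · -- `η^w_t ∈ S₂`
      exact (S.not_isRegularLocalRing_gen_iff hp k f hdegV hrange hcompat w hchw t.1).mpr
        ⟨t.1, t.2, subset_rfl⟩
    · -- every `η ∈ G` is under some `η^w_t` ((B) at `w`)
      obtain ⟨hηw, hηS⟩ := hη
      obtain ⟨q, rfl⟩ : η ∈ Set.range (V.fromSpecStalk w) := by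
        rw [Scheme.range_fromSpecStalk]; exact hηw
      obtain ⟨t, ht, hspec⟩ :=
        (S.not_isRegularLocalRing_fromSpecStalk_iff_exists_pair hp k f hdegV hrange hcompat w hchw q).mp hηS
      exact ⟨⟨t, ht⟩, hspec⟩
    · exact Subtype.ext (S.eq_of_gen_specializes_of_card_eq w h
        ((hcardt t.1 _ t.2).trans (hcardt t'.1 _ t'.2).symm))
    · -- `η_t ∈ S₂` for a pair `t` of charged coordinates of `v`
      exact (S.not_isRegularLocalRing_gen_iff hp k f hdegV hrange hcompat v hch t.1).mpr
        ⟨t.1, (Finset.mem_filter.mp t.2).1, subset_rfl⟩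
    · -- every `η ∈ G` is under some `η_t ⤳ w` ((C) at `η ∈ U₁`)
      obtain ⟨hηw, hηS⟩ := hη
      have hηU : η ∈ U₁ := hηw.mem_open U₁.isOpen hw₁
      obtain ⟨t, ht, hspec⟩ := (hU₁ η hηU).mp hηS
      exact ⟨⟨t, Finset.mem_filter.mpr ⟨ht, hspec.trans hηw⟩⟩, hspec⟩
    · exact Subtype.ext (S.eq_of_gen_specializes_of_card_eq v h
        ((hcardt t.1 _ (Finset.mem_filter.mp t.2).1).trans
          (hcardt t'.1 _ (Finset.mem_filter.mp t'.2).1).symm))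
  /- Step C: read off the binomial counts -/
  set c := ((S.ch v).filter fun i => S.gen v {i} ⤳ w).card with hc_def
  have hι : Fintype.card ι = (S.ch w).card.choose 2 := by
    rw [Fintype.card_coe, Finset.card_powersetCard]
  have hfilter : ((S.ch v).powersetCard 2).filter (fun t => S.gen v t ⤳ w) =
      ((S.ch v).filter fun i => S.gen v {i} ⤳ w).powersetCard 2 := by
    ext t
    rw [Finset.mem_filter, Finset.mem_powersetCard, Finset.mem_powersetCard]
    constructor
    · rintro ⟨⟨hsub, hcard⟩, hspec⟩
      refine ⟨fun i hi => Finset.mem_filter.mpr ⟨hsub hi, ?_⟩, hcard⟩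
      exact (hpair t (Finset.mem_powersetCard.mpr ⟨hsub, hcard⟩)).mp hspec i hi
    · rintro ⟨hsub, hcard⟩
      have hsub' : t ⊆ S.ch v := fun i hi => (Finset.mem_filter.mp (hsub hi)).1
      refine ⟨⟨hsub', hcard⟩, ?_⟩
      exact (hpair t (Finset.mem_powersetCard.mpr ⟨hsub', hcard⟩)).mpr
        fun i hi => (Finset.mem_filter.mp (hsub hi)).2
  have hι' : Fintype.card ι' = c.choose 2 := by
    rw [Fintype.card_coe, hfilter, Finset.card_powersetCard]
  rw [hι, hι'] at hcount
  exact eq_of_two_le_of_choose_two_eq hchw2 hcount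

end GameState

end Summit.ResolutionOfSingularities.ResolutionOfSingularities.Theorems.RadicialJung.CleanModelsSuffice

end
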